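import Mathlib
import Summits.Ventures.PercRepro2.Defs
import Summits.Ventures.PercRepro2.Graph
import Summits.Ventures.PercRepro2.OneColourSwitch
import Summits.Ventures.PercRepro2.RegionHubSign
import Summits.Ventures.PercRepro2.SideSwitch
import Summits.Ventures.PercRepro2.SideSwitchFibre
import Summits.Ventures.PercRepro2.SideSwitchClosed
import Summits.Ventures.PercRepro2.SideSwitchComps
import Summits.Ventures.PercRepro2.M9NoPocketDefs
import Summits.Ventures.PercRepro2.M9NoPocketWorld
import Summits.Ventures.PercRepro2.M9NoPocketWorldD
import Summits.Ventures.PercRepro2.M9NoPocketCompl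
import Summits.Ventures.PercRepro2.M9PsiOneDefs
import Summits.Ventures.PercRepro2.M9NoPocketFreeBlock

/-!
# The link lemma for dead patterns (blind cell PercRepro2, p3 g35, 2026-08-29;
`proofs/P3-NPHDR.md` §5(b), (h))

A DEAD PATTERN `flipF D ρ` (some edges at `d` turned to `W`) is again a representative with the
same blocks (`flipF_mem_RepD`, `blocks_flipF`): the `G − d` part is untouched.  For its
assignments with only FREE blocks switched the legality half of `K2_assignX` is automatic (a free
block has no edge from `d`), so the link lemma of `M9NoPocketFreeBlock` transfers: switching a
NON-linking free block does not change `r ~_Y s` of a dirty `K`-point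
(`conn_rs_insert_free_iff_flipF`).  Hence the `Y`-link of a dirty `K`-point depends only on the
dead pattern and on the linking free blocks' sides — step (b) of THEOREMS RK-NP / 2EXHD-NP in
the kernel vocabulary.  Own work; std axioms.
-/

namespace Summit.Ventures.PercRepro2

namespace NoPocket

open Finset Classical RegionHub OneColourSwitch SideSwitch

variable {V : Type*} {E : Type*}

section Dead

variable [Fintype V] [DecidableEq V] [Fintype E] [DecidableEq E] {ends : E → Sym2 V}

omit [Fintype V] [DecidableEq V] [Fintype E] in
/-- A dead pattern agrees with the representative off the edges at `d`. -/
lemma flipF_eqOn_off_d {d : V} {D : Finset E} {ρ : Config E} (hD : ∀ e ∈ D, d ∈ ends e) :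
    ∀ e, d ∉ ends e → ρ e = flipF D ρ e := by
  intro e he
  have : e ∉ D := fun h => he (hD e h)
  rw [flipF_of_notMem this]

/-- A dead pattern of a representative is a representative (no `T`-edges). -/
lemma flipF_mem_RepD {p q r s d : V} {ρ : Config E} (hρ : ρ ∈ RepD ends p q r s d)
    (hT : Tset ends d r s = ∅) {D : Finset E} (hD : ∀ e ∈ D, d ∈ ends e) :
    flipF D ρ ∈ RepD ends p q r s d := by
  obtain ⟨hsep, hM, _⟩ := mem_RepD.1 hρ
  have heq := flipF_eqOn_off_d (ends := ends) (ρ := ρ) hD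
  refine mem_RepD.2 ⟨?_, ?_, ?_⟩
  · obtain ⟨h1, h2⟩ := hsep
    refine ⟨?_, ?_⟩
    · obtain ⟨a, b, c, e⟩ := h1
      exact ⟨fun h => a ((conn_endsD_iff_of_eqOn heq).2 h),
        fun h => b ((conn_endsD_iff_of_eqOn heq).2 h),
        fun h => c ((conn_endsD_iff_of_eqOn heq).2 h),
        fun h => e ((conn_endsD_iff_of_eqOn heq).2 h)⟩
    · obtain ⟨a, b, c, e⟩ := h2
      have heq' : ∀ e, d ∉ ends e →
          OneColourSwitch.compl ρ e = OneColourSwitch.compl (flipF D ρ) e := by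
        intro e he
        simp [OneColourSwitch.compl, heq e he]
      exact ⟨fun h => a ((conn_endsD_iff_of_eqOn heq').2 h),
        fun h => b ((conn_endsD_iff_of_eqOn heq').2 h),
        fun h => c ((conn_endsD_iff_of_eqOn heq').2 h),
        fun h => e ((conn_endsD_iff_of_eqOn heq').2 h)⟩
  · intro y hy
    rw [← M2_endsD_eq_of_eqOn heq] at hy
    exact hM y hy
  · intro e he
    rw [hT] at he
    exact absurd he (Finset.notMem_empty e)

omit [Fintype E] in
/-- A dead pattern has the blocks of its representative. -/
lemma blocks_flipF {d r s : V} {ρ : Config E} {D : Finset E} (hD : ∀ e ∈ D, d ∈ ends e) :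
    blocks ends d r s (flipF D ρ) = blocks ends d r s ρ := by
  have heq := flipF_eqOn_off_d (ends := ends) (ρ := ρ) hD
  have hA : A0 (endsD ends d) r s (flipF D ρ) = A0 (endsD ends d) r s ρ := by
    ext y
    simp only [mem_A0]
    rw [K2_endsD_eq_of_eqOn heq, M2_endsD_eq_of_eqOn heq]
  simp only [blocks, comps, hA]

omit [Fintype V] [DecidableEq V] [Fintype E] [DecidableEq E] in
/-- A free block has no `W` edge from `d`. -/
lemma not_hasW_of_free {d : V} {ρ : Config E} {C : Finset V} (hfree : Free ends d C) :
    ¬ hasW ends d ρ C := by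
  rintro ⟨e, y, hy, hends, _⟩
  exact hfree e y hy hends

/-- The `Y`-world of the assignment with a free block `C` switched avoids `C`, when every
switched block is free. -/
lemma notMem_C_of_mem_K2_insert_free {p q r s d : V} (hnp : NoPocketAt ends d r s)
    {ρ : Config E} (hρ : ρ ∈ RepD ends p q r s d) (hr : d ≠ r) (hs : d ≠ s)
    {x : Finset (Finset V) × Finset E} (hT : x.1 ⊆ blocks ends d r s ρ) (hx2 : x.2 = ∅)
    (hxfree : ∀ C' ∈ x.1, Free ends d C') {C : Finset V} (hC : C ∈ blocks ends d r s ρ)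
    (hCfree : Free ends d C) {z : V}
    (hz : z ∈ K2 ends r s (assignX ends (insert C x.1, x.2) ρ)) : z ∉ C := by
  intro hzC
  have hT' : (insert C x.1, x.2).1 ⊆ blocks ends d r s ρ := Finset.insert_subset hC hT
  have hF' : (insert C x.1, x.2).2 ⊆ Tset ends d r s := by
    show x.2 ⊆ _
    rw [hx2]; exact Finset.empty_subset _
  have hL : srcY ends d r s ρ (insert C x.1, x.2) →
      ∀ C' ∈ (insert C x.1, x.2).1, ¬ hasW ends d ρ C' := by
    intro _ C' hC'
    rcases Finset.mem_insert.1 hC' with rfl | hC'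
    · exact not_hasW_of_free hCfree
    · exact not_hasW_of_free (hxfree C' hC')
  rw [K2_assignX hnp hρ hT' hF' hr hs hL] at hz
  rcases hz with hz | ⟨rfl, _⟩
  · rw [K2_endsD_assignX hρ hT' hF'] at hz
    exact hz.2 (Finset.mem_coe.2 (mem_unionT.2 ⟨C, Finset.mem_insert_self _ _, hzC⟩))
  · exact (block_vertex_ne hρ hC hzC hr hs).2.2 rfl

/-- Switching a free block cannot create a `Y`-link (every switched block free). -/
theorem conn_rs_of_insert_free {p q r s d : V} (hnp : NoPocketAt ends d r s) {ρ : Config E}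
    (hρ : ρ ∈ RepD ends p q r s d) (hr : d ≠ r) (hs : d ≠ s)
    {x : Finset (Finset V) × Finset E} (hT : x.1 ⊆ blocks ends d r s ρ) (hx2 : x.2 = ∅)
    (hxfree : ∀ C' ∈ x.1, Free ends d C') {C : Finset V} (hC : C ∈ blocks ends d r s ρ)
    (hCfree : Free ends d C)
    (h : Conn ends (assignX ends (insert C x.1, x.2) ρ) r s) : Conn ends (assignX ends x ρ) r s := by
  have key : s ∈ {z | z ∈ K2 ends r s (assignX ends (insert C x.1, x.2) ρ) ∧
      Conn ends (assignX ends x ρ) r z} := by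
    refine mem_of_conn_of_closed (ends := ends) (ω := assignX ends (insert C x.1, x.2) ρ) ?_
      ⟨r_mem_K2 r s _, conn_refl _ _ _⟩ h
    rintro u ⟨huK, hu⟩ v hadj
    obtain ⟨_, e, he, hends⟩ := openGraph_adj.1 hadj
    have hvK : v ∈ K2 ends r s (assignX ends (insert C x.1, x.2) ρ) := mem_K2_of_open huK he hends
    have hnt : e ∉ touches ends (↑C : Set V) := by
      rintro ⟨w, hw, z, hwz⟩
      have hwe : w ∈ ends e := by rw [hwz]; exact Sym2.mem_mk_left _ _
      rw [hends, Sym2.mem_iff] at hwe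
      rcases hwe with rfl | rfl
      · exact notMem_C_of_mem_K2_insert_free hnp hρ hr hs hT hx2 hxfree hC hCfree huK
          (Finset.mem_coe.1 hw)
      · exact notMem_C_of_mem_K2_insert_free hnp hρ hr hs hT hx2 hxfree hC hCfree hvK
          (Finset.mem_coe.1 hw)
    have he2 : assignX ends x ρ e = true := by
      rw [← assignX_insert_eq_of_not_touches (x := x) (ρ := ρ) hnt]; exact he
    exact ⟨hvK, conn_trans hu (conn_of_openAdj ⟨e, he2, hends⟩)⟩
  exact key.2

/-- **The link lemma for a dirty `K`-point**: for a dead pattern `flipF D ρ` and an assignment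
switching only free blocks, switching a further NON-linking free block does not change
`r ~_Y s`. -/
theorem conn_rs_insert_free_iff_flipF {p q r s d : V} (hnp : NoPocketAt ends d r s)
    {ρ : Config E} (hρ : ρ ∈ RepD ends p q r s d) (hTset : Tset ends d r s = ∅) (hr : d ≠ r)
    (hs : d ≠ s) {D : Finset E} (hD : ∀ e ∈ D, d ∈ ends e)
    {x : Finset (Finset V) × Finset E} (hT : x.1 ⊆ blocks ends d r s ρ) (hx2 : x.2 = ∅)
    (hxfree : ∀ C' ∈ x.1, Free ends d C') {C : Finset V} (hC : C ∈ blocks ends d r s ρ)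
    (hCx : C ∉ x.1) (hCfree : Free ends d C) (hnl : ¬ LinksIn ends (flipF D ρ) r s C) :
    Conn ends (assignX ends (insert C x.1, x.2) (flipF D ρ)) r s ↔
      Conn ends (assignX ends x (flipF D ρ)) r s := by
  have hρD := flipF_mem_RepD hρ hTset hD
  have hb := blocks_flipF (ends := ends) (r := r) (s := s) (ρ := ρ) hD
  have hT' : x.1 ⊆ blocks ends d r s (flipF D ρ) := by rw [hb]; exact hT
  have hC' : C ∈ blocks ends d r s (flipF D ρ) := by rw [hb]; exact hC
  exact ⟨conn_rs_of_insert_free hnp hρD hr hs hT' hx2 hxfree hC' hCfree,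
    conn_rs_insert_of_conn hρD hr hs hT' hx2 hC' hCx hCfree hnl⟩

end Dead

end NoPocket

end Summit.Ventures.PercRepro2
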